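import Literature.Computability.MetaComplexity.PartialBijections
import Literature.Computability.MetaComplexity.Frege
import Literature.Computability.MetaComplexity.Resolution
import HarnessLib

/-!
# `k`-evaluations of bounded-depth Frege proofs (Krajíček 1995, §12.4–12.5)

Topic `Literature/Computability/MetaComplexity`. Second layer (after `PartialBijections.lean`,
Krajíček 1995 §12.3) of the Krajíček–Pudlák–Woods / Pitassi–Beame–Impagliazzo exponential
lower bound for bounded-depth Frege proofs of the pigeonhole principle, in the complete-systems
formulation of J. Krajíček, *Bounded arithmetic, propositional logic, and complexity theory*
(CUP 1995), §12.4–12.5: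

* block children `PropForm.dkids` / `PropForm.ckids` of a disjunction / conjunction (the
  unbounded fan-in reading of the binary connectives of `PropForm`, matching the alternation
  depth `PropForm.altDepth` of `Frege.lean`), the subformula set `PropForm.subforms`;
* `KEval n ρ k Γ` (Def. 12.4.1, adapted): a `k`-evaluation of a subformula-closed set `Γ` of
  formulas in the pigeonhole variables `x = i * n + j` (`p_{ij}`, pigeon `i ≤ n`, hole `j < n`,
  as in `pigeonholeCNF (n+1) n`) *relative to a restriction* `ρ` (a partial matching of
  `range (n+1) × range n`): maps `H, S` assigning to every formula a `k`-complete system `S φ`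
  over the restricted universe and its "true part" `H φ ⊆ S φ`, respecting constants, atoms
  (live / set true / killed by `ρ`), negation (complement), disjunction blocks (projection of the
  union of the children's true parts, which must be refined by `S φ`) and, dually, conjunction
  blocks;
* **Lemma 12.4.2** (`KEval.restrict`): restricting a `k`-evaluation by a further matching `ρ'`
  of the current universe gives a `k`-evaluation relative to `ρ ∪ ρ'`;
* **Lemma 12.4.4** for the concrete Frege system `textbookFrege` (`KEval.H_eq_S_of_isInferred`,
  `KEval.H_eq_S_of_isDerivation`):
  if `18 k ≤ |R|` then every line of a `textbookFrege`-proof all of whose subformulas lie in `Γ`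
  is *true* in the evaluation (`H θ = S θ`) — via the Boolean homomorphism `φ ↦ T(H φ)` into the
  subsets of a common refinement `T` of the systems of the (≤ 9) subformula instances of a rule;
* **Lemma 12.5.2** (adapted to the injective `PHP^{n+1}_n` of `pigeonholeCNF`,
  `KEval.H_pigeonholeForm_eq_empty`): the pigeonhole tautology
  `pigeonholeForm (n+1) n = ¬ ⋀ PHP^{n+1}_n` is *false* in every `k`-evaluation with
  `2k + 2 ≤ |R|` (every pigeon and hole clause is forced true);
* the contradiction **`KEval.not_isProofOf_pigeonhole`** (the combinatorial core of
  Thm. 12.5.3): no `k`-evaluation with `18 k + 3 ≤ |R|` evaluates all subformulas of a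
  `textbookFrege`-proof of `pigeonholeForm (n+1) n`.

The existence of `k`-evaluations after a suitable restriction (Thm. 12.4.3, via the PHP
switching lemma 12.3.10) is NOT in this file.

## References

* J. Krajíček, *Bounded arithmetic, propositional logic, and complexity theory*, CUP 1995,
  Def. 12.4.1, Lemma 12.4.2, Lemma 12.4.4, Lemma 12.5.2, Thm. 12.5.3 [Krajicek1995].
* J. Krajíček, P. Pudlák, A. Woods, *An exponential lower bound to the size of bounded depth
  Frege proofs of the pigeonhole principle*, Random Structures Algorithms 7 (1995) 15–39
  [KrajicekPudlakWoods1995].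
* T. Pitassi, P. Beame, R. Impagliazzo, *Exponential lower bounds for the pigeonhole
  principle*, Comput. Complexity 3 (1993) 97–140 [PitassiBeameImpagliazzo1993].

## Design choices (deviations from the printed Def. 12.4.1)

* Evaluations are indexed by the ORIGINAL formulas and carry the restriction `ρ` as a
  parameter, instead of evaluating the restricted formulas `φ^ρ` (the map `φ ↦ φ^ρ` is not
  injective, so `(H^ρ, S^ρ)` is not a function of `φ^ρ`); the atom clauses read the status of
  `p_{ij}` under `ρ`.
* The atom clauses are relaxed to what Lemmas 12.4.4 and 12.5.2 use and what is stable under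
  restriction: a *live* atom (`i ∉ dom ρ`, `j ∉ rng ρ`, `x < (n+1) n`) has the `2`-complete atom
  system of Lemma 12.3.2 and `H = {{(i,j)}}`; an atom *set true* by `ρ` (`(i,j) ∈ ρ`) has `H = S`;
  any other (*killed*, or a variable that is not a pigeonhole variable) has `H = ∅` — with `S` an
  arbitrary `k`-complete system in the last two cases (Krajíček: `S = {∅}`; after restricting a
  live atom system one gets a `1`-complete pigeon/hole system instead, which the printed proof
  glosses over).
* Conjunction is primitive in `PropForm` (Krajíček's language is `¬, ⋁`); its clause is the
  dual of the disjunction clause. Binary `disj`/`conj` are read as unbounded fan-in blocks through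
  `dkids`/`ckids`, exactly as `PropForm.altDepth` counts depth.
-/

namespace Literature.Computability.Complexity.PropForm

/-! ### Block children and subformulas (dot-extensions of `PropForm`, cf. `Frege.lean`) -/

variable {ν : Type*} [DecidableEq ν]

/-- The *block children* of a formula read as an unbounded fan-in disjunction: for `φ ∨ ψ` the
block children of `φ` and of `ψ`, for any other formula the formula itself. (So a maximal block
of nested binary `disj` is one `⋁` whose arguments are its block children, as in the alternation
depth `PropForm.altDepth`.) (Dot-extension of G01's `PropForm`.)
[cite: Krajicek1995, Def. 4.3.2 and §12.4 (⋁_i φ_i)] -/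
def dkids : PropForm ν → Finset (PropForm ν)
  | disj φ ψ => dkids φ ∪ dkids ψ
  | var x => {var x}
  | const b => {const b}
  | neg φ => {neg φ}
  | conj φ ψ => {conj φ ψ}

/-- The block children of a formula read as an unbounded fan-in conjunction (dual of `dkids`).
(Dot-extension of G01's `PropForm`.) [cite: Krajicek1995, Def. 4.3.2] -/
def ckids : PropForm ν → Finset (PropForm ν)
  | conj φ ψ => ckids φ ∪ ckids ψ
  | var x => {var x}
  | const b => {const b}
  | neg φ => {neg φ}
  | disj φ ψ => {disj φ ψ}

/-- The finite set of subformulas of a formula (the formula itself included).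
(Dot-extension of G01's `PropForm`.) [cite: Krajicek1995, §12.5 (proof of Thm. 12.5.3: Γ = the subformulas of the proof)] -/
def subforms : PropForm ν → Finset (PropForm ν)
  | var x => {var x}
  | const b => {const b}
  | neg φ => insert (neg φ) (subforms φ)
  | conj φ ψ => insert (conj φ ψ) (subforms φ ∪ subforms ψ)
  | disj φ ψ => insert (disj φ ψ) (subforms φ ∪ subforms ψ)

/-- Block children of a disjunction. [folklore] -/
@[simp] theorem dkids_disj (φ ψ : PropForm ν) : dkids (disj φ ψ) = dkids φ ∪ dkids ψ := rfl
/-- Block children of a variable. [folklore] -/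
@[simp] theorem dkids_var (x : ν) : dkids (var x) = {var x} := rfl
/-- Block children of a constant. [folklore] -/
@[simp] theorem dkids_const (b : Bool) : dkids (const b : PropForm ν) = {const b} := rfl
/-- Block children of a negation (read disjunctively). [folklore] -/
@[simp] theorem dkids_neg (φ : PropForm ν) : dkids (neg φ) = {neg φ} := rfl
/-- Block children of a conjunction (read disjunctively). [folklore] -/
@[simp] theorem dkids_conj (φ ψ : PropForm ν) : dkids (conj φ ψ) = {conj φ ψ} := rfl
/-- Conjunctive block children of a conjunction. [folklore] -/
@[simp] theorem ckids_conj (φ ψ : PropForm ν) : ckids (conj φ ψ) = ckids φ ∪ ckids ψ := rfl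
/-- Conjunctive block children of a variable. [folklore] -/
@[simp] theorem ckids_var (x : ν) : ckids (var x) = {var x} := rfl
/-- Conjunctive block children of a constant. [folklore] -/
@[simp] theorem ckids_const (b : Bool) : ckids (const b : PropForm ν) = {const b} := rfl
/-- Conjunctive block children of a negation. [folklore] -/
@[simp] theorem ckids_neg (φ : PropForm ν) : ckids (neg φ) = {neg φ} := rfl
/-- Conjunctive block children of a disjunction. [folklore] -/
@[simp] theorem ckids_disj (φ ψ : PropForm ν) : ckids (disj φ ψ) = {disj φ ψ} := rfl

/-- Every formula is a subformula of itself. [folklore] -/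
@[simp] theorem self_mem_subforms (φ : PropForm ν) : φ ∈ subforms φ := by
  cases φ <;> simp [subforms]

/-- Subformulas of subformulas are subformulas. [folklore] -/
theorem subforms_subset_of_mem {φ ψ : PropForm ν} (h : ψ ∈ subforms φ) :
    subforms ψ ⊆ subforms φ := by
  induction φ with
  | var x => simp only [subforms, Finset.mem_singleton] at h; subst h; simp [subforms]
  | const b => simp only [subforms, Finset.mem_singleton] at h; subst h; simp [subforms]
  | neg φ ih =>
    simp only [subforms, Finset.mem_insert] at h
    rcases h with rfl | h
    · exact le_rfl
    · exact (ih h).trans (Finset.subset_insert _ _)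
  | conj φ χ ihφ ihχ =>
    simp only [subforms, Finset.mem_insert, Finset.mem_union] at h
    rcases h with rfl | h | h
    · exact le_rfl
    · exact (ihφ h).trans ((Finset.subset_union_left).trans (Finset.subset_insert _ _))
    · exact (ihχ h).trans ((Finset.subset_union_right).trans (Finset.subset_insert _ _))
  | disj φ χ ihφ ihχ =>
    simp only [subforms, Finset.mem_insert, Finset.mem_union] at h
    rcases h with rfl | h | h
    · exact le_rfl
    · exact (ihφ h).trans ((Finset.subset_union_left).trans (Finset.subset_insert _ _))
    · exact (ihχ h).trans ((Finset.subset_union_right).trans (Finset.subset_insert _ _))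

/-- The argument of a negation is a subformula. [folklore] -/
theorem mem_subforms_neg (φ : PropForm ν) : φ ∈ subforms (neg φ) := by
  simp [subforms]

/-- The left argument of a conjunction is a subformula. [folklore] -/
theorem left_mem_subforms_conj (φ ψ : PropForm ν) : φ ∈ subforms (conj φ ψ) := by
  simp [subforms]

/-- The right argument of a conjunction is a subformula. [folklore] -/
theorem right_mem_subforms_conj (φ ψ : PropForm ν) : ψ ∈ subforms (conj φ ψ) := by
  simp [subforms]

/-- The left argument of a disjunction is a subformula. [folklore] -/
theorem left_mem_subforms_disj (φ ψ : PropForm ν) : φ ∈ subforms (disj φ ψ) := by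
  simp [subforms]

/-- The right argument of a disjunction is a subformula. [folklore] -/
theorem right_mem_subforms_disj (φ ψ : PropForm ν) : ψ ∈ subforms (disj φ ψ) := by
  simp [subforms]

/-- The number of subformulas is at most the size. [cite: Krajicek1995, §12.5 (|π| ≥ |Γ| in the proof of Thm. 12.5.3)] -/
theorem card_subforms_le_size (φ : PropForm ν) : (subforms φ).card ≤ φ.size := by
  induction φ with
  | var x => simp [subforms, size]
  | const b => simp [subforms, size]
  | neg φ ih => exact (Finset.card_insert_le _ _).trans (by simp [size]; omega)
  | conj φ ψ ihφ ihψ =>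
    refine (Finset.card_insert_le _ _).trans ?_
    have := Finset.card_union_le (subforms φ) (subforms ψ)
    simp [size]; omega
  | disj φ ψ ihφ ihψ =>
    refine (Finset.card_insert_le _ _).trans ?_
    have := Finset.card_union_le (subforms φ) (subforms ψ)
    simp [size]; omega

/-- Disjunctive block children are subformulas. [folklore] -/
theorem dkids_subset_subforms (φ : PropForm ν) : dkids φ ⊆ subforms φ := by
  induction φ with
  | var x => simp [dkids, subforms]
  | const b => simp [dkids, subforms]
  | neg φ _ => simp [dkids]
  | conj φ ψ _ _ => simp [dkids]
  | disj φ ψ ihφ ihψ =>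
    rw [dkids_disj]
    exact Finset.union_subset
      (ihφ.trans (subforms_subset_of_mem (left_mem_subforms_disj φ ψ)))
      (ihψ.trans (subforms_subset_of_mem (right_mem_subforms_disj φ ψ)))

/-- Conjunctive block children are subformulas. [folklore] -/
theorem ckids_subset_subforms (φ : PropForm ν) : ckids φ ⊆ subforms φ := by
  induction φ with
  | var x => simp [ckids, subforms]
  | const b => simp [ckids, subforms]
  | neg φ _ => simp [ckids]
  | disj φ ψ _ _ => simp [ckids]
  | conj φ ψ ihφ ihψ =>
    rw [ckids_conj]
    exact Finset.union_subset
      (ihφ.trans (subforms_subset_of_mem (left_mem_subforms_conj φ ψ)))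
      (ihψ.trans (subforms_subset_of_mem (right_mem_subforms_conj φ ψ)))

/-- A formula that is not a disjunction is its own unique disjunctive block child. [folklore] -/
theorem dkids_eq_singleton_of_ne {φ : PropForm ν} (h : ∀ a b, φ ≠ disj a b) : dkids φ = {φ} := by
  cases φ with
  | disj a b => exact absurd rfl (h a b)
  | _ => rfl

/-- A formula that is not a conjunction is its own unique conjunctive block child. [folklore] -/
theorem ckids_eq_singleton_of_ne {φ : PropForm ν} (h : ∀ a b, φ ≠ conj a b) : ckids φ = {φ} := by
  cases φ with
  | conj a b => exact absurd rfl (h a b)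
  | _ => rfl

/-! ### Alternation depth of subformulas and block children -/

omit [DecidableEq ν] in
/-- The auxiliary depth below a parent is at most the depth, and at least the depth minus one.
[cite: Krajicek1995, Def. 4.3.2] -/
theorem altDepthAux_le_altDepth (c : ℕ) (φ : PropForm ν) :
    altDepthAux c φ ≤ altDepth φ ∧ altDepth φ ≤ altDepthAux c φ + 1 := by
  cases φ with
  | var _ => simp [altDepth, altDepthAux]
  | const _ => simp [altDepth, altDepthAux]
  | neg φ =>
    simp only [altDepth, altDepthAux, show (0 : ℕ) ≠ 1 by decide, if_false]
    split_ifs <;> omega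
  | conj φ ψ =>
    simp only [altDepth, altDepthAux, show (0 : ℕ) ≠ 2 by decide, if_false]
    split_ifs <;> omega
  | disj φ ψ =>
    simp only [altDepth, altDepthAux, show (0 : ℕ) ≠ 3 by decide, if_false]
    split_ifs <;> omega

omit [DecidableEq ν] in
/-- Below a `disj` parent, a non-disjunction has its full alternation depth. [cite: Krajicek1995, Def. 4.3.2] -/
theorem altDepthAux_three_of_ne {φ : PropForm ν} (h : ∀ a b, φ ≠ disj a b) :
    altDepthAux 3 φ = altDepth φ := by
  cases φ with
  | disj a b => exact absurd rfl (h a b)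
  | _ => simp [altDepth, altDepthAux]

omit [DecidableEq ν] in
/-- Below a `conj` parent, a non-conjunction has its full alternation depth. [cite: Krajicek1995, Def. 4.3.2] -/
theorem altDepthAux_two_of_ne {φ : PropForm ν} (h : ∀ a b, φ ≠ conj a b) :
    altDepthAux 2 φ = altDepth φ := by
  cases φ with
  | conj a b => exact absurd rfl (h a b)
  | _ => simp [altDepth, altDepthAux]

/-- The disjunctive block children of `φ` have auxiliary depth (below `disj`) at most that of
`φ`. [cite: Krajicek1995, Def. 4.3.2] -/
theorem altDepthAux_three_le_of_mem_dkids {φ ξ : PropForm ν} (h : ξ ∈ dkids φ) :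
    altDepthAux 3 ξ ≤ altDepthAux 3 φ := by
  induction φ with
  | var x => simp only [dkids_var, Finset.mem_singleton] at h; rw [h]
  | const b => simp only [dkids_const, Finset.mem_singleton] at h; rw [h]
  | neg φ _ => simp only [dkids_neg, Finset.mem_singleton] at h; rw [h]
  | conj φ ψ _ _ => simp only [dkids_conj, Finset.mem_singleton] at h; rw [h]
  | disj φ ψ ihφ ihψ =>
    rw [dkids_disj, Finset.mem_union] at h
    simp only [altDepthAux, if_true, Nat.add_zero]
    rcases h with h | h
    · exact (ihφ h).trans (le_max_left _ _)
    · exact (ihψ h).trans (le_max_right _ _)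

/-- The conjunctive block children of `φ` have auxiliary depth (below `conj`) at most that of
`φ`. [cite: Krajicek1995, Def. 4.3.2] -/
theorem altDepthAux_two_le_of_mem_ckids {φ ξ : PropForm ν} (h : ξ ∈ ckids φ) :
    altDepthAux 2 ξ ≤ altDepthAux 2 φ := by
  induction φ with
  | var x => simp only [ckids_var, Finset.mem_singleton] at h; rw [h]
  | const b => simp only [ckids_const, Finset.mem_singleton] at h; rw [h]
  | neg φ _ => simp only [ckids_neg, Finset.mem_singleton] at h; rw [h]
  | disj φ ψ _ _ => simp only [ckids_disj, Finset.mem_singleton] at h; rw [h]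
  | conj φ ψ ihφ ihψ =>
    rw [ckids_conj, Finset.mem_union] at h
    simp only [altDepthAux, if_true, Nat.add_zero]
    rcases h with h | h
    · exact (ihφ h).trans (le_max_left _ _)
    · exact (ihψ h).trans (le_max_right _ _)

/-- Block children of a disjunction are not disjunctions. [folklore] -/
theorem ne_disj_of_mem_dkids {φ ξ : PropForm ν} (h : ξ ∈ dkids φ) (a b : PropForm ν) :
    ξ ≠ disj a b := by
  induction φ with
  | var x => simp only [dkids_var, Finset.mem_singleton] at h; rw [h]; exact fun h' => by cases h'
  | const c => simp only [dkids_const, Finset.mem_singleton] at h; rw [h]; exact fun h' => by cases h'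
  | neg φ _ => simp only [dkids_neg, Finset.mem_singleton] at h; rw [h]; exact fun h' => by cases h'
  | conj φ ψ _ _ => simp only [dkids_conj, Finset.mem_singleton] at h; rw [h]; exact fun h' => by cases h'
  | disj φ ψ ihφ ihψ =>
    rw [dkids_disj, Finset.mem_union] at h
    exact h.elim ihφ ihψ

/-- Block children of a conjunction are not conjunctions. [folklore] -/
theorem ne_conj_of_mem_ckids {φ ξ : PropForm ν} (h : ξ ∈ ckids φ) (a b : PropForm ν) :
    ξ ≠ conj a b := by
  induction φ with
  | var x => simp only [ckids_var, Finset.mem_singleton] at h; rw [h]; exact fun h' => by cases h'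
  | const c => simp only [ckids_const, Finset.mem_singleton] at h; rw [h]; exact fun h' => by cases h'
  | neg φ _ => simp only [ckids_neg, Finset.mem_singleton] at h; rw [h]; exact fun h' => by cases h'
  | disj φ ψ _ _ => simp only [ckids_disj, Finset.mem_singleton] at h; rw [h]; exact fun h' => by cases h'
  | conj φ ψ ihφ ihψ =>
    rw [ckids_conj, Finset.mem_union] at h
    exact h.elim ihφ ihψ

/-- **Depth drops across a disjunction block**: the block children of a disjunction `φ ∨ ψ`
have alternation depth strictly below that of `φ ∨ ψ`. [cite: Krajicek1995, Def. 4.3.2 (depth of ⋁_i φ_i is 1 + max depth φ_i)] -/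
theorem altDepth_lt_of_mem_dkids_disj {φ ψ ξ : PropForm ν} (h : ξ ∈ dkids (disj φ ψ)) :
    altDepth ξ < altDepth (disj φ ψ) := by
  have h1 := altDepthAux_three_le_of_mem_dkids h
  have h2 : altDepthAux 3 ξ = altDepth ξ := altDepthAux_three_of_ne (ne_disj_of_mem_dkids h)
  simp only [altDepthAux, if_true, Nat.add_zero] at h1
  simp only [altDepth, altDepthAux, show (0 : ℕ) ≠ 3 by decide, if_false]
  rw [altDepth] at h2
  omega

/-- **Depth drops across a conjunction block** (dual). [cite: Krajicek1995, Def. 4.3.2] -/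
theorem altDepth_lt_of_mem_ckids_conj {φ ψ ξ : PropForm ν} (h : ξ ∈ ckids (conj φ ψ)) :
    altDepth ξ < altDepth (conj φ ψ) := by
  have h1 := altDepthAux_two_le_of_mem_ckids h
  have h2 : altDepthAux 2 ξ = altDepth ξ := altDepthAux_two_of_ne (ne_conj_of_mem_ckids h)
  simp only [altDepthAux, if_true, Nat.add_zero] at h1
  simp only [altDepth, altDepthAux, show (0 : ℕ) ≠ 2 by decide, if_false]
  rw [altDepth] at h2
  omega

omit [DecidableEq ν] in
/-- The alternation depth of an immediate subformula is at most that of the formula.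
[cite: Krajicek1995, Def. 4.3.2] -/
theorem altDepth_neg_ge (φ : PropForm ν) : altDepth φ ≤ altDepth (neg φ) := by
  have := altDepthAux_le_altDepth 1 φ
  simp only [altDepth, altDepthAux, show (0 : ℕ) ≠ 1 by decide, if_false] at this ⊢
  omega

omit [DecidableEq ν] in
/-- Depth monotonicity for the arguments of a conjunction. [cite: Krajicek1995, Def. 4.3.2] -/
theorem altDepth_conj_ge (φ ψ : PropForm ν) :
    altDepth φ ≤ altDepth (conj φ ψ) ∧ altDepth ψ ≤ altDepth (conj φ ψ) := by
  have h1 := altDepthAux_le_altDepth 2 φ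
  have h2 := altDepthAux_le_altDepth 2 ψ
  simp only [altDepth, altDepthAux, show (0 : ℕ) ≠ 2 by decide, if_false] at h1 h2 ⊢
  omega

omit [DecidableEq ν] in
/-- Depth monotonicity for the arguments of a disjunction. [cite: Krajicek1995, Def. 4.3.2] -/
theorem altDepth_disj_ge (φ ψ : PropForm ν) :
    altDepth φ ≤ altDepth (disj φ ψ) ∧ altDepth ψ ≤ altDepth (disj φ ψ) := by
  have h1 := altDepthAux_le_altDepth 3 φ
  have h2 := altDepthAux_le_altDepth 3 ψ
  simp only [altDepth, altDepthAux, show (0 : ℕ) ≠ 3 by decide, if_false] at h1 h2 ⊢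
  omega

/-- **Subformulas have no larger alternation depth.** [cite: Krajicek1995, Def. 4.3.2] -/
theorem altDepth_le_of_mem_subforms {φ ψ : PropForm ν} (h : ψ ∈ subforms φ) :
    altDepth ψ ≤ altDepth φ := by
  induction φ with
  | var x => simp only [subforms, Finset.mem_singleton] at h; rw [h]
  | const b => simp only [subforms, Finset.mem_singleton] at h; rw [h]
  | neg φ ih =>
    simp only [subforms, Finset.mem_insert] at h
    rcases h with rfl | h
    · exact le_rfl
    · exact (ih h).trans (altDepth_neg_ge φ)
  | conj φ χ ihφ ihχ =>
    simp only [subforms, Finset.mem_insert, Finset.mem_union] at h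
    rcases h with rfl | h | h
    · exact le_rfl
    · exact (ihφ h).trans (altDepth_conj_ge φ χ).1
    · exact (ihχ h).trans (altDepth_conj_ge φ χ).2
  | disj φ χ ihφ ihχ =>
    simp only [subforms, Finset.mem_insert, Finset.mem_union] at h
    rcases h with rfl | h | h
    · exact le_rfl
    · exact (ihφ h).trans (altDepth_disj_ge φ χ).1
    · exact (ihχ h).trans (altDepth_disj_ge φ χ).2

end Literature.Computability.Complexity.PropForm

namespace Literature.Computability.MetaComplexity

open Complexity Complexity.PropForm PBij Finset

/-! ### Subformula-closed sets and pigeonhole atoms -/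

/-- `SubClosed Γ`: the finite set of formulas `Γ` is closed under subformulas.
[cite: Krajicek1995, Def. 12.4.1 (Γ closed under subformulas)] -/
def SubClosed (Γ : Finset (PropForm ℕ)) : Prop :=
  ∀ φ ∈ Γ, subforms φ ⊆ Γ

namespace SubClosed

variable {Γ : Finset (PropForm ℕ)}

/-- In a subformula-closed set, the argument of a member negation is a member. [folklore] -/
theorem mem_of_neg (h : SubClosed Γ) {φ : PropForm ℕ} (hφ : PropForm.neg φ ∈ Γ) : φ ∈ Γ :=
  h _ hφ (mem_subforms_neg φ)

/-- Closure for the left argument of a conjunction. [folklore] -/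
theorem mem_of_conj_left (h : SubClosed Γ) {φ ψ : PropForm ℕ} (hφ : PropForm.conj φ ψ ∈ Γ) :
    φ ∈ Γ :=
  h _ hφ (left_mem_subforms_conj φ ψ)

/-- Closure for the right argument of a conjunction. [folklore] -/
theorem mem_of_conj_right (h : SubClosed Γ) {φ ψ : PropForm ℕ} (hφ : PropForm.conj φ ψ ∈ Γ) :
    ψ ∈ Γ :=
  h _ hφ (right_mem_subforms_conj φ ψ)

/-- Closure for the left argument of a disjunction. [folklore] -/
theorem mem_of_disj_left (h : SubClosed Γ) {φ ψ : PropForm ℕ} (hφ : PropForm.disj φ ψ ∈ Γ) :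
    φ ∈ Γ :=
  h _ hφ (left_mem_subforms_disj φ ψ)

/-- Closure for the right argument of a disjunction. [folklore] -/
theorem mem_of_disj_right (h : SubClosed Γ) {φ ψ : PropForm ℕ} (hφ : PropForm.disj φ ψ ∈ Γ) :
    ψ ∈ Γ :=
  h _ hφ (right_mem_subforms_disj φ ψ)

/-- Closure under all subformulas. [folklore] -/
theorem mem_of_mem_subforms (h : SubClosed Γ) {φ ψ : PropForm ℕ} (hφ : φ ∈ Γ)
    (hψ : ψ ∈ subforms φ) : ψ ∈ Γ :=
  h _ hφ hψ

/-- Disjunctive block children of a member are members. [folklore] -/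
theorem dkids_subset (h : SubClosed Γ) {φ : PropForm ℕ} (hφ : φ ∈ Γ) : dkids φ ⊆ Γ :=
  (dkids_subset_subforms φ).trans (h φ hφ)

/-- Conjunctive block children of a member are members. [folklore] -/
theorem ckids_subset (h : SubClosed Γ) {φ : PropForm ℕ} (hφ : φ ∈ Γ) : ckids φ ⊆ Γ :=
  (ckids_subset_subforms φ).trans (h φ hφ)

end SubClosed

/-- The set of subformulas of a formula is subformula-closed. [folklore] -/
theorem subClosed_subforms (φ : PropForm ℕ) : SubClosed (subforms φ) :=
  fun _ hψ => subforms_subset_of_mem hψ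

/-- A union of subformula-closed sets is subformula-closed. [folklore] -/
theorem SubClosed.union {Γ Γ' : Finset (PropForm ℕ)} (h : SubClosed Γ) (h' : SubClosed Γ') :
    SubClosed (Γ ∪ Γ') := by
  intro φ hφ
  rw [Finset.mem_union] at hφ
  rcases hφ with hφ | hφ
  · exact (h φ hφ).trans Finset.subset_union_left
  · exact (h' φ hφ).trans Finset.subset_union_right

/-- An indexed union of subformula-closed sets is subformula-closed. [folklore] -/
theorem subClosed_biUnion {ι : Type*} (I : Finset ι) (f : ι → Finset (PropForm ℕ))
    (h : ∀ i ∈ I, SubClosed (f i)) : SubClosed (I.biUnion f) := by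
  intro φ hφ
  rw [Finset.mem_biUnion] at hφ
  obtain ⟨i, hi, hφ⟩ := hφ
  exact (h i hi φ hφ).trans (Finset.subset_biUnion_of_mem f hi)

/-- The pigeon–hole pair `(i, j) = (x / n, x % n)` of the variable `x = i * n + j` of
`pigeonholeCNF (n+1) n` (pigeon `i`, hole `j`). [cite: Krajicek1995, Def. 12.4.1(4) (atoms p_{ij})] -/
def atomOf (n x : ℕ) : ℕ × ℕ :=
  (x / n, x % n)

/-- The variable of the atom `p_{ij}`: `atomOf n (i * n + j) = (i, j)` for `j < n`. [folklore] -/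
theorem atomOf_mul_add {n i j : ℕ} (hj : j < n) : atomOf n (i * n + j) = (i, j) := by
  have hn : 0 < n := by omega
  unfold atomOf
  rw [Nat.mul_comm, Nat.mul_add_div hn, Nat.div_eq_of_lt hj, Nat.add_zero, Nat.mul_add_mod,
    Nat.mod_eq_of_lt hj]

/-- A pigeonhole variable (`x < (n+1) n`) has pigeon `≤ n` and hole `< n`. [folklore] -/
theorem atomOf_mem_product {n x : ℕ} (hx : x < (n + 1) * n) :
    atomOf n x ∈ range (n + 1) ×ˢ range n := by
  have hn : 0 < n := Nat.pos_of_ne_zero (by rintro rfl; simp at hx)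
  rw [Finset.mem_product, Finset.mem_range, Finset.mem_range]
  refine ⟨?_, Nat.mod_lt _ hn⟩
  unfold atomOf
  exact (Nat.div_lt_iff_lt_mul hn).2 hx

/-- Conversely, a variable whose atom lies in `range (n+1) × range n` (with `0 < n`) is a
pigeonhole variable. [folklore] -/
theorem lt_of_atomOf_mem_product {n x : ℕ} (hn : 0 < n)
    (h : atomOf n x ∈ range (n + 1) ×ˢ range n) : x < (n + 1) * n := by
  rw [Finset.mem_product, Finset.mem_range, Finset.mem_range] at h
  unfold atomOf at h
  exact (Nat.div_lt_iff_lt_mul hn).1 h.1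

/-! ### `k`-evaluations (Krajíček 1995, Def. 12.4.1, relative to a restriction `ρ`) -/

/-- `IsLiveAtom n ρ x`: the variable `x` is a pigeonhole variable `p_{ij}` (`x < (n+1) n`) whose
pigeon `i` and hole `j` are both untouched by the restriction `ρ` (`(p_{ij})^ρ = p_{ij}`).
[cite: Krajicek1995, Lemma 12.4.2 (case (p_X)^ρ = p_X)] -/
def IsLiveAtom (n : ℕ) (ρ : Finset (ℕ × ℕ)) (x : ℕ) : Prop :=
  x < (n + 1) * n ∧ (atomOf n x).1 ∉ dom ρ ∧ (atomOf n x).2 ∉ rng ρ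

/-- **`k`-evaluations** (Krajíček 1995, Def. 12.4.1, for `𝓜 = 𝓜^{PHP}`, adapted as explained in
the module docstring). `KEval n ρ k Γ` is a `k`-evaluation of the set of formulas `Γ` in the
pigeonhole variables of `PHP^{n+1}_n`, relative to the restriction `ρ` (a matching of
`range (n+1) × range n`): over the restricted universe `D = range (n+1) ∖ dom ρ`,
`R = range n ∖ rng ρ` it assigns to each formula a `k`-complete system `S φ` and a subset
`H φ ⊆ S φ` (the elements forcing `φ` true) such that constants, atoms, negations, disjunction
blocks and conjunction blocks are respected. [cite: Krajicek1995, Def. 12.4.1] -/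
structure KEval (n : ℕ) (ρ : Finset (ℕ × ℕ)) (k : ℕ) (Γ : Finset (PropForm ℕ)) where
  /-- the true part `H_φ` -/
  H : PropForm ℕ → Finset (Finset (ℕ × ℕ))
  /-- the complete system `S_φ` -/
  S : PropForm ℕ → Finset (Finset (ℕ × ℕ))
  /-- `ρ` is a matching -/
  isPMatching : IsPMatching ρ
  /-- `ρ` lives in the pigeonhole universe -/
  ρ_subset : ρ ⊆ range (n + 1) ×ˢ range n
  /-- (2) every `S_φ` is `k`-complete over the restricted universe -/
  complete : ∀ φ ∈ Γ, IsKComplete (range (n + 1) \ dom ρ) (range n \ rng ρ) k (S φ)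
  /-- (1) `H_φ ⊆ S_φ` -/
  subset : ∀ φ ∈ Γ, H φ ⊆ S φ
  /-- (3) the constant `1` is true -/
  H_true : PropForm.const true ∈ Γ → H (.const true) = S (.const true)
  /-- (3) the constant `0` is false -/
  H_false : PropForm.const false ∈ Γ → H (.const false) = ∅
  /-- (4) a live atom `p_{ij}` has the `2`-complete atom system and `H = {{(i,j)}}` -/
  live : ∀ x, PropForm.var x ∈ Γ → IsLiveAtom n ρ x →
    S (.var x) = atomSystem (range (n + 1) \ dom ρ) (range n \ rng ρ) (atomOf n x).1 (atomOf n x).2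
      ∧ H (.var x) = {{atomOf n x}}
  /-- (4^ρ) an atom set true by `ρ` is true -/
  setTrue : ∀ x, PropForm.var x ∈ Γ → atomOf n x ∈ ρ → H (.var x) = S (.var x)
  /-- (4^ρ) any other atom (killed by `ρ`, or not a pigeonhole variable) is false -/
  dead : ∀ x, PropForm.var x ∈ Γ → atomOf n x ∉ ρ → ¬ IsLiveAtom n ρ x → H (.var x) = ∅
  /-- (5) negation: same system -/
  neg_S : ∀ φ, PropForm.neg φ ∈ Γ → S (.neg φ) = S φ
  /-- (5) negation: complementary true part -/
  neg_H : ∀ φ, PropForm.neg φ ∈ Γ → H (.neg φ) = S φ \ H φ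
  /-- (6) disjunction blocks: `⋃_i H_{φ_i} ◁ S_φ` -/
  disj_refines : ∀ φ ψ, PropForm.disj φ ψ ∈ Γ →
    Refines ((dkids (.disj φ ψ)).biUnion H) (S (.disj φ ψ))
  /-- (6) disjunction blocks: `H_φ = S_φ(⋃_i H_{φ_i})` -/
  disj_H : ∀ φ ψ, PropForm.disj φ ψ ∈ Γ →
    H (.disj φ ψ) = proj (S (.disj φ ψ)) ((dkids (.disj φ ψ)).biUnion H)
  /-- (6∧) conjunction blocks (dual): `⋃_i (S_{φ_i} ∖ H_{φ_i}) ◁ S_φ` -/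
  conj_refines : ∀ φ ψ, PropForm.conj φ ψ ∈ Γ →
    Refines ((ckids (.conj φ ψ)).biUnion fun ξ => S ξ \ H ξ) (S (.conj φ ψ))
  /-- (6∧) conjunction blocks (dual): `H_φ = S_φ ∖ S_φ(⋃_i (S_{φ_i} ∖ H_{φ_i}))` -/
  conj_H : ∀ φ ψ, PropForm.conj φ ψ ∈ Γ →
    H (.conj φ ψ) = S (.conj φ ψ) \ proj (S (.conj φ ψ)) ((ckids (.conj φ ψ)).biUnion fun ξ => S ξ \ H ξ)

namespace KEval

variable {n k : ℕ} {ρ : Finset (ℕ × ℕ)} {Γ : Finset (PropForm ℕ)}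

/-- The pigeons of the restricted universe, `D^ρ = range (n+1) ∖ dom ρ`. [cite: Krajicek1995, Def. 12.3.8] -/
abbrev D (_E : KEval n ρ k Γ) : Finset ℕ := range (n + 1) \ dom ρ

/-- The holes of the restricted universe, `R^ρ = range n ∖ rng ρ`. [cite: Krajicek1995, Def. 12.3.8] -/
abbrev R (_E : KEval n ρ k Γ) : Finset ℕ := range n \ rng ρ

/-- `|D^ρ| = |R^ρ| + 1`. [cite: Krajicek1995, §12.3 (|D| = n + 1, |R| = n)] -/
theorem card_D (E : KEval n ρ k Γ) : E.D.card = E.R.card + 1 := by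
  have h1 := card_restrictedDomain E.isPMatching E.ρ_subset
  have h2 := card_restrictedRange E.isPMatching E.ρ_subset
  simp only [Finset.card_range] at h1 h2
  change (range (n + 1) \ dom ρ).card = (range n \ rng ρ).card + 1
  omega

/-- `|R^ρ| + |ρ| = n`. [cite: Krajicek1995, Def. 12.3.8 (n^ρ = n - |ρ|)] -/
theorem card_R_add (E : KEval n ρ k Γ) : E.R.card + ρ.card = n := by
  have := card_restrictedRange E.isPMatching E.ρ_subset
  simpa using this

/-- The union of the true parts of the disjunctive block children, `⋃_i H_{φ_i}` (for a
non-disjunction this is `H_φ` itself). [cite: Krajicek1995, Def. 12.4.1(6)] -/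
def dU (E : KEval n ρ k Γ) (φ : PropForm ℕ) : Finset (Finset (ℕ × ℕ)) :=
  (dkids φ).biUnion E.H

/-- The union of the false parts of the conjunctive block children, `⋃_i (S_{φ_i} ∖ H_{φ_i})`.
[cite: Krajicek1995, Def. 12.4.1(6) (dual form for ∧)] -/
def cU (E : KEval n ρ k Γ) (φ : PropForm ℕ) : Finset (Finset (ℕ × ℕ)) :=
  (ckids φ).biUnion fun ξ => E.S ξ \ E.H ξ

/-- `⋃ H` over the block children of `φ ∨ ψ` splits. [cite: Krajicek1995, Lemma 12.4.4 (proof, disjunction case)] -/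
theorem dU_disj (E : KEval n ρ k Γ) (φ ψ : PropForm ℕ) :
    E.dU (.disj φ ψ) = E.dU φ ∪ E.dU ψ := by
  simp [dU, Finset.union_biUnion]

/-- `⋃ (S ∖ H)` over the block children of `φ ∧ ψ` splits. [folklore] -/
theorem cU_conj (E : KEval n ρ k Γ) (φ ψ : PropForm ℕ) :
    E.cU (.conj φ ψ) = E.cU φ ∪ E.cU ψ := by
  simp [cU, Finset.union_biUnion]

/-- For a non-disjunction, `dU φ = H φ`. [folklore] -/
theorem dU_of_ne (E : KEval n ρ k Γ) {φ : PropForm ℕ} (h : ∀ a b, φ ≠ .disj a b) :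
    E.dU φ = E.H φ := by
  simp [dU, dkids_eq_singleton_of_ne h]

/-- For a non-conjunction, `cU φ = S φ ∖ H φ`. [folklore] -/
theorem cU_of_ne (E : KEval n ρ k Γ) {φ : PropForm ℕ} (h : ∀ a b, φ ≠ .conj a b) :
    E.cU φ = E.S φ \ E.H φ := by
  simp [cU, ckids_eq_singleton_of_ne h]

/-- **Uniform disjunction clause**: for every `φ ∈ Γ`, `⋃ H(dkids φ) ◁ S_φ` and
`H_φ = S_φ(⋃ H(dkids φ))` (for a non-disjunction both are trivial since the union is `H_φ ⊆ S_φ`).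
[cite: Krajicek1995, Def. 12.4.1(6)] -/
theorem dU_spec (E : KEval n ρ k Γ) {φ : PropForm ℕ} (hφ : φ ∈ Γ) :
    Refines (E.dU φ) (E.S φ) ∧ E.H φ = proj (E.S φ) (E.dU φ) := by
  by_cases h : ∃ a b, φ = .disj a b
  · obtain ⟨a, b, rfl⟩ := h
    exact ⟨E.disj_refines a b hφ, E.disj_H a b hφ⟩
  · push Not at h
    rw [E.dU_of_ne h]
    exact ⟨refines_of_subset (E.complete φ hφ) (E.subset φ hφ),
      (proj_eq_of_subset (E.complete φ hφ) (E.subset φ hφ)).symm⟩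

/-- **Uniform conjunction clause** (dual of `dU_spec`). [cite: Krajicek1995, Def. 12.4.1(6)] -/
theorem cU_spec (E : KEval n ρ k Γ) {φ : PropForm ℕ} (hφ : φ ∈ Γ) :
    Refines (E.cU φ) (E.S φ) ∧ E.H φ = E.S φ \ proj (E.S φ) (E.cU φ) := by
  by_cases h : ∃ a b, φ = .conj a b
  · obtain ⟨a, b, rfl⟩ := h
    exact ⟨E.conj_refines a b hφ, E.conj_H a b hφ⟩
  · push Not at h
    rw [E.cU_of_ne h]
    refine ⟨refines_of_subset (E.complete φ hφ) Finset.sdiff_subset, ?_⟩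
    rw [proj_eq_of_subset (E.complete φ hφ) Finset.sdiff_subset,
      Finset.sdiff_sdiff_eq_self (E.subset φ hφ)]

/-- Elements of the unions `dU` are members of the systems of block children: matchings of
the universe of size `≤ k` (for `Γ` subformula-closed). [folklore] -/
theorem exists_mem_of_mem_dU (E : KEval n ρ k Γ) {φ : PropForm ℕ} {γ : Finset (ℕ × ℕ)}
    (h : γ ∈ E.dU φ) : ∃ ξ ∈ dkids φ, γ ∈ E.H ξ := by
  simpa [dU] using h

/-- Elements of `cU φ` come from the false part of a conjunctive block child. [folklore] -/
theorem exists_mem_of_mem_cU (E : KEval n ρ k Γ) {φ : PropForm ℕ} {γ : Finset (ℕ × ℕ)}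
    (h : γ ∈ E.cU φ) : ∃ ξ ∈ ckids φ, γ ∈ E.S ξ \ E.H ξ := by
  simpa [cU] using h

/-! ### Lemma 12.4.2: restricting an evaluation -/

section Restrict

variable (E : KEval n ρ k Γ) (hΓ : SubClosed Γ) {ρ' : Finset (ℕ × ℕ)}
  (hρ' : IsPMatching ρ') (hρ's : ρ' ⊆ E.D ×ˢ E.R)

include hρ' hρ's in
/-- A matching of the restricted universe is compatible with `ρ`, so `ρ ∪ ρ'` is a matching.
[cite: Krajicek1995, Lemma 12.3.9(2) (proof)] -/
theorem isPMatching_union : IsPMatching (ρ ∪ ρ') :=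
  compat_of_subset_restrictedUniverse E.isPMatching hρ' hρ's

include hρ's in
/-- `ρ ∪ ρ'` stays inside the pigeonhole universe. [folklore] -/
theorem union_subset_product : ρ ∪ ρ' ⊆ range (n + 1) ×ˢ range n :=
  Finset.union_subset E.ρ_subset
    (hρ's.trans (Finset.product_subset_product Finset.sdiff_subset Finset.sdiff_subset))

omit hρ' hρ's in
/-- The pigeons of the twice restricted universe. [cite: Krajicek1995, Def. 12.3.8] -/
theorem D_sdiff : E.D \ dom ρ' = range (n + 1) \ dom (ρ ∪ ρ') := by
  rw [dom_union]; exact sdiff_sdiff_left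

omit hρ' hρ's in
/-- The holes of the twice restricted universe. [cite: Krajicek1995, Def. 12.3.8] -/
theorem R_sdiff : E.R \ rng ρ' = range n \ rng (ρ ∪ ρ') := by
  rw [rng_union]; exact sdiff_sdiff_left

include hΓ hρ' hρ's in
/-- **Lemma 12.4.2** (restriction of a `k`-evaluation). If `(H, S)` is a `k`-evaluation of the
subformula-closed `Γ` relative to `ρ`, and `ρ'` is a matching of the restricted universe, then
`(H^{ρ'}, S^{ρ'}) = (restrict ρ' ∘ H, restrict ρ' ∘ S)` is a `k`-evaluation of `Γ` relative to
`ρ ∪ ρ'`. [cite: Krajicek1995, Lemma 12.4.2] -/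
def restrict : KEval n (ρ ∪ ρ') k Γ where
  H φ := PBij.restrict ρ' (E.H φ)
  S φ := PBij.restrict ρ' (E.S φ)
  isPMatching := E.isPMatching_union hρ' hρ's
  ρ_subset := E.union_subset_product hρ's
  complete φ hφ := by
    rw [← E.D_sdiff, ← E.R_sdiff]
    exact (E.complete φ hφ).restrict hρ' hρ's
  subset φ hφ := restrict_mono ρ' (E.subset φ hφ)
  H_true h := by simp only [E.H_true h]
  H_false h := by simp only [E.H_false h, restrict_empty]
  live x hx hl := by
    obtain ⟨hxn, hd, hr⟩ := hl
    rw [dom_union, Finset.mem_union, not_or] at hd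
    rw [rng_union, Finset.mem_union, not_or] at hr
    obtain ⟨hS, hH⟩ := E.live x hx ⟨hxn, hd.1, hr.1⟩
    simp only [hS, hH]
    rw [restrict_atomSystem_of_fresh hρ' hd.2 hr.2, E.D_sdiff, E.R_sdiff,
      restrict_singleton_singleton_of_fresh hρ' hd.2 hr.2]
    exact ⟨rfl, rfl⟩
  setTrue x hx hmem := by
    rw [Finset.mem_union] at hmem
    rcases hmem with hmem | hmem
    · simp only [E.setTrue x hx hmem]
    · -- the atom was live w.r.t. `ρ` and is set true by `ρ'`
      by_cases hmemρ : atomOf n x ∈ ρ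
      · simp only [E.setTrue x hx hmemρ]
      have hp := Finset.mem_product.1 (hρ's hmem)
      simp only [Finset.mem_sdiff, Finset.mem_range] at hp
      have hn : 0 < n := Nat.pos_of_ne_zero (by rintro rfl; exact absurd hp.2.1 (Nat.not_lt_zero _))
      have hlive : IsLiveAtom n ρ x :=
        ⟨lt_of_atomOf_mem_product hn (Finset.mem_product.2
          ⟨Finset.mem_range.2 hp.1.1, Finset.mem_range.2 hp.2.1⟩), hp.1.2, hp.2.2⟩
      obtain ⟨hS, hH⟩ := E.live x hx hlive
      have hmem' : ((atomOf n x).1, (atomOf n x).2) ∈ ρ' := by simpa using hmem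
      simp only [hS, hH]
      rw [restrict_atomSystem_of_mem hρ' hmem', ← Prod.mk.eta (p := atomOf n x),
        restrict_singleton_singleton_of_mem hρ' hmem']
  dead x hx hnot hnl := by
    rw [Finset.mem_union, not_or] at hnot
    by_cases hl : IsLiveAtom n ρ x
    · -- live w.r.t. `ρ`, killed by `ρ'`
      obtain ⟨hS, hH⟩ := E.live x hx hl
      simp only [hH]
      apply restrict_singleton_singleton_of_not_compat
      intro hc
      apply hnl
      refine ⟨hl.1, ?_, ?_⟩
      · rw [dom_union, Finset.mem_union, not_or]
        refine ⟨hl.2.1, fun hd => hnot.2 ?_⟩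
        exact hc.symm.mem_of_mem_dom hd
      · rw [rng_union, Finset.mem_union, not_or]
        refine ⟨hl.2.2, fun hr => hnot.2 ?_⟩
        exact hc.symm.mem_of_mem_rng hr
    · simp only [E.dead x hx hnot.1 hl, restrict_empty]
  neg_S φ hφ := by simp only [E.neg_S φ hφ]
  neg_H φ hφ := by
    have hφ' : φ ∈ Γ := hΓ.mem_of_neg hφ
    simp only [E.neg_H φ hφ]
    exact restrict_sdiff (E.complete φ hφ') (E.subset φ hφ') ρ'
  disj_refines φ ψ hφ := by
    have h := E.disj_refines φ ψ hφ
    rw [← restrict_biUnion]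
    exact h.restrict ρ'
  disj_H φ ψ hφ := by
    simp only [E.disj_H φ ψ hφ]
    rw [← restrict_biUnion]
    exact restrict_proj (E.disj_refines φ ψ hφ) (E.complete _ hφ).isPMatching ρ'
  conj_refines φ ψ hφ := by
    have h := E.conj_refines φ ψ hφ
    have hkids : ∀ ξ ∈ ckids (PropForm.conj φ ψ),
        PBij.restrict ρ' (E.S ξ) \ PBij.restrict ρ' (E.H ξ) = PBij.restrict ρ' (E.S ξ \ E.H ξ) := by
      intro ξ hξ
      have hξΓ : ξ ∈ Γ := hΓ.ckids_subset hφ hξ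
      exact (restrict_sdiff (E.complete ξ hξΓ) (E.subset ξ hξΓ) ρ').symm
    rw [Finset.biUnion_congr rfl hkids, ← restrict_biUnion]
    exact h.restrict ρ'
  conj_H φ ψ hφ := by
    have hkids : ∀ ξ ∈ ckids (PropForm.conj φ ψ),
        PBij.restrict ρ' (E.S ξ) \ PBij.restrict ρ' (E.H ξ) = PBij.restrict ρ' (E.S ξ \ E.H ξ) := by
      intro ξ hξ
      have hξΓ : ξ ∈ Γ := hΓ.ckids_subset hφ hξ
      exact (restrict_sdiff (E.complete ξ hξΓ) (E.subset ξ hξΓ) ρ').symm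
    simp only [E.conj_H φ ψ hφ]
    rw [Finset.biUnion_congr rfl hkids, ← restrict_biUnion,
      restrict_sdiff (E.complete _ hφ) (proj_subset _ _) ρ',
      restrict_proj (E.conj_refines φ ψ hφ) (E.complete _ hφ).isPMatching ρ']

/-- The true parts of the restricted evaluation. [cite: Krajicek1995, Lemma 12.4.2] -/
@[simp] theorem restrict_H (φ : PropForm ℕ) :
    (E.restrict hΓ hρ' hρ's).H φ = PBij.restrict ρ' (E.H φ) := rfl

/-- The systems of the restricted evaluation. [cite: Krajicek1995, Lemma 12.4.2] -/
@[simp] theorem restrict_S (φ : PropForm ℕ) :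
    (E.restrict hΓ hρ' hρ's).S φ = PBij.restrict ρ' (E.S φ) := rfl

end Restrict

/-! ### Lemma 12.4.4: the Boolean homomorphism into a common refinement -/

section Hom

variable (E : KEval n ρ k Γ) (L : List (PropForm ℕ))

/-- The common refinement `T` of the systems `S_φ`, `φ ∈ L` (for the subformula instances `L`
of a rule). [cite: Krajicek1995, Lemma 12.4.4 (proof: "Take T to be a common refinement of all S_γ")] -/
def T : Finset (Finset (ℕ × ℕ)) :=
  crefineList (L.map E.S)

/-- The valuation `φ ↦ T(H_φ)` into the Boolean algebra of subsets of `T`.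
[cite: Krajicek1995, Lemma 12.4.4 (proof: "The mapping γ → T(H_γ)")] -/
def v (φ : PropForm ℕ) : Finset (Finset (ℕ × ℕ)) :=
  proj (E.T L) (E.H φ)

variable {L}

/-- `T` is `(|L|·k)`-complete. [cite: Krajicek1995, Lemma 12.4.4, Lemma 12.3.5] -/
theorem isKComplete_T (hL : ∀ φ ∈ L, φ ∈ Γ) : IsKComplete E.D E.R (L.length * k) (E.T L) := by
  have := isKComplete_crefineList (D := E.D) (R := E.R) (k := k) (L.map E.S) (by
    intro S hS
    obtain ⟨φ, hφ, rfl⟩ := List.mem_map.1 hS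
    exact E.complete φ (hL φ hφ))
  simpa [T] using this

/-- `T` refines every `S_φ`, `φ ∈ L`, provided `2 |L| k ≤ |R|`. [cite: Krajicek1995, Lemma 12.4.4, Lemmas 12.3.4–12.3.5] -/
theorem refines_T (hL : ∀ φ ∈ L, φ ∈ Γ) (h2 : 2 * (L.length * k) ≤ E.R.card) {φ : PropForm ℕ}
    (hφ : φ ∈ L) : Refines (E.S φ) (E.T L) := by
  have := refines_crefineList (D := E.D) (R := E.R) (k := k) (L.map E.S) (by
    intro S hS
    obtain ⟨ψ, hψ, rfl⟩ := List.mem_map.1 hS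
    exact E.complete ψ (hL ψ hψ)) (by simpa using h2) (E.S φ) (List.mem_map_of_mem hφ)
  simpa [T] using this

/-- The valuation takes values in the subsets of `T`. [folklore] -/
theorem v_subset (φ : PropForm ℕ) : E.v L φ ⊆ E.T L :=
  proj_subset _ _

/-- The side conditions used below: `|L| ≤ 9` and `18 k ≤ |R|` give room for Lemmas 12.3.4–12.3.7.
[cite: Krajicek1995, Lemma 12.4.4 (the constant r)] -/
structure HomHyp (E : KEval n ρ k Γ) (L : List (PropForm ℕ)) : Prop where
  /-- the instance subformulas lie in `Γ` -/
  mem : ∀ φ ∈ L, φ ∈ Γ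
  /-- at most `9` of them -/
  length_le : L.length ≤ 9
  /-- room: `18 k ≤ n^ρ` -/
  le_card : 18 * k ≤ E.R.card

namespace HomHyp

variable {E} (hh : HomHyp E L)
include hh

/-- Room for Lemma 12.3.4: `2 |L| k ≤ |R|`. [folklore] -/
theorem two_mul_le : 2 * (L.length * k) ≤ E.R.card := by
  have h1 := hh.length_le
  have h2 := hh.le_card
  have : 2 * (L.length * k) ≤ 18 * k := by nlinarith
  omega

/-- Room for Lemma 12.3.6: `k + |L| k ≤ |R|`. [folklore] -/
theorem add_le : k + L.length * k ≤ E.R.card := by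
  have h1 := hh.length_le
  have h2 := hh.le_card
  have : k + L.length * k ≤ 18 * k := by nlinarith
  omega

/-- `T` refines each `S_φ`, `φ ∈ L`. [cite: Krajicek1995, Lemma 12.4.4 (proof)] -/
theorem refines {φ : PropForm ℕ} (hφ : φ ∈ L) : Refines (E.S φ) (E.T L) :=
  E.refines_T hh.mem hh.two_mul_le hφ

/-- `T` is complete. [cite: Krajicek1995, Lemma 12.4.4 (proof)] -/
theorem complete_T : IsKComplete E.D E.R (L.length * k) (E.T L) :=
  E.isKComplete_T hh.mem

/-- **Truth is detected by `T`**: for `φ ∈ L`, `T(H_φ) = T ↔ H_φ = S_φ`.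
[cite: Krajicek1995, Lemma 12.4.4 (last step, via Lemma 12.3.6)] -/
theorem v_eq_T_iff {φ : PropForm ℕ} (hφ : φ ∈ L) : E.v L φ = E.T L ↔ E.H φ = E.S φ := by
  have hφΓ := hh.mem φ hφ
  have key := proj_eq_self_iff (refines_of_subset (E.complete φ hφΓ) (E.subset φ hφΓ))
    (hh.refines hφ) (E.complete φ hφΓ) hh.complete_T hh.add_le
  rw [proj_eq_of_subset (E.complete φ hφΓ) (E.subset φ hφΓ)] at key
  exact key.symm

/-- **Negation is complement**: `T(H_{¬φ}) = T ∖ T(H_φ)`. [cite: Krajicek1995, Lemma 12.4.4 (proof, negation case via Lemma 12.3.7)] -/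
theorem v_neg {φ : PropForm ℕ} (hφ : φ ∈ L) (hnφ : PropForm.neg φ ∈ Γ) :
    E.v L (.neg φ) = E.T L \ E.v L φ := by
  have hφΓ := hh.mem φ hφ
  unfold v
  rw [E.neg_H φ hnφ]
  exact proj_sdiff (hh.refines hφ) (E.complete φ hφΓ) hh.complete_T hh.add_le (E.subset φ hφΓ)

/-- `T(H_φ) = T(⋃_i H_{φ_i})` for the disjunctive block children. [cite: Krajicek1995, Lemma 12.4.4 (proof, disjunction case via Lemma 12.3.6)] -/
theorem v_eq_proj_dU {φ : PropForm ℕ} (hφ : φ ∈ L) : E.v L φ = proj (E.T L) (E.dU φ) := by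
  have hφΓ := hh.mem φ hφ
  obtain ⟨hr, hH⟩ := E.dU_spec hφΓ
  unfold v
  rw [hH]
  exact proj_proj hr (hh.refines hφ) (E.complete φ hφΓ) hh.complete_T hh.add_le

/-- **Disjunction is union**: `T(H_{a ∨ b}) = T(H_a) ∪ T(H_b)` (all three in `L`).
[cite: Krajicek1995, Lemma 12.4.4 (proof, disjunction case)] -/
theorem v_disj {a b : PropForm ℕ} (ha : a ∈ L) (hb : b ∈ L) (hab : PropForm.disj a b ∈ L) :
    E.v L (.disj a b) = E.v L a ∪ E.v L b := by
  rw [hh.v_eq_proj_dU hab, hh.v_eq_proj_dU ha, hh.v_eq_proj_dU hb, dU_disj, proj_union]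

/-- `T(H_φ) = T ∖ T(⋃_i (S_{φ_i} ∖ H_{φ_i}))` for the conjunctive block children. [cite: Krajicek1995, Lemma 12.4.4 (dual of the disjunction case)] -/
theorem v_eq_sdiff_proj_cU {φ : PropForm ℕ} (hφ : φ ∈ L) :
    E.v L φ = E.T L \ proj (E.T L) (E.cU φ) := by
  have hφΓ := hh.mem φ hφ
  obtain ⟨hr, hH⟩ := E.cU_spec hφΓ
  unfold v
  rw [hH, proj_sdiff (hh.refines hφ) (E.complete φ hφΓ) hh.complete_T hh.add_le (proj_subset _ _),
    proj_proj hr (hh.refines hφ) (E.complete φ hφΓ) hh.complete_T hh.add_le]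

/-- **Conjunction is intersection**: `T(H_{a ∧ b}) = T(H_a) ∩ T(H_b)` (all three in `L`).
[cite: Krajicek1995, Lemma 12.4.4 (dual of the disjunction case)] -/
theorem v_conj {a b : PropForm ℕ} (ha : a ∈ L) (hb : b ∈ L) (hab : PropForm.conj a b ∈ L) :
    E.v L (.conj a b) = E.v L a ∩ E.v L b := by
  rw [hh.v_eq_sdiff_proj_cU hab, hh.v_eq_sdiff_proj_cU ha, hh.v_eq_sdiff_proj_cU hb, cU_conj,
    proj_union, Finset.sdiff_union_distrib]

end HomHyp

end Hom

/-! ### Lemma 12.4.4 for `textbookFrege`: inferred lines are true -/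

section Rules

variable (E : KEval n ρ k Γ)

/-- Set algebra of rule (1), `⊢ ¬A ∨ A`: `(T ∖ a) ∪ a = T` for `a ⊆ T`. [folklore] -/
theorem sdiff_union_of_subset {α : Type*} [DecidableEq α] {T a : Finset α} (ha : a ⊆ T) :
    T \ a ∪ a = T := by
  rw [Finset.sdiff_union_self_eq_union, Finset.union_eq_left.2 ha]

/-- Set algebra of the cut rule: `a ∪ b = T`, `(T ∖ a) ∪ c = T` give `b ∪ c = T` (inside `T`). [folklore] -/
theorem cut_algebra {α : Type*} [DecidableEq α] {T a b c : Finset α} (hb : b ⊆ T) (hc : c ⊆ T)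
    (h₁ : a ∪ b = T) (h₂ : T \ a ∪ c = T) : b ∪ c = T := by
  refine Finset.Subset.antisymm (Finset.union_subset hb hc) fun τ hτ => ?_
  rw [Finset.mem_union]
  by_cases hτa : τ ∈ a
  · have : τ ∈ T \ a ∪ c := by rw [h₂]; exact hτ
    rw [Finset.mem_union, Finset.mem_sdiff] at this
    rcases this with h | h
    · exact absurd hτa h.2
    · exact Or.inr h
  · have : τ ∈ a ∪ b := by rw [h₁]; exact hτ
    rw [Finset.mem_union] at this
    rcases this with h | h
    · exact absurd h hτa
    · exact Or.inl h

/-- Set algebra of the first conjunction axiom: `(T ∖ (a ∩ b)) ∪ (T ∖ ((T ∖ a) ∪ (T ∖ b))) = T`. [folklore] -/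
theorem conjAx₁_algebra {α : Type*} [DecidableEq α] (T a b : Finset α) :
    T \ (a ∩ b) ∪ T \ (T \ a ∪ T \ b) = T := by
  ext τ
  simp only [Finset.mem_union, Finset.mem_sdiff, Finset.mem_inter, not_or, not_and, not_not]
  tauto

/-- Set algebra of the second conjunction axiom: `(T ∖ (T ∖ ((T ∖ a) ∪ (T ∖ b)))) ∪ (a ∩ b) = T`
for `a, b ⊆ T`. [folklore] -/
theorem conjAx₂_algebra {α : Type*} [DecidableEq α] {T a b : Finset α} (ha : a ⊆ T) (hb : b ⊆ T) :
    T \ (T \ (T \ a ∪ T \ b)) ∪ a ∩ b = T := by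
  ext τ
  have ha' := @ha τ
  have hb' := @hb τ
  simp only [Finset.mem_union, Finset.mem_sdiff, Finset.mem_inter]
  tauto

/-- **Lemma 12.4.4 for `textbookFrege`.** Let `(H, S)` be a `k`-evaluation of the
subformula-closed set `Γ` with `18 k ≤ |R^ρ|`. If `θ ∈ Γ` is inferred by a rule of
`textbookFrege` from earlier lines which lie in `Γ` and are true (`H = S`), then `θ` is true.
(The printed lemma is for an arbitrary Frege rule with a constant `r` exceeding the number of its
subformulas; for the nine rules of `textbookFrege` we take `r = 18` and check each rule in the
Boolean algebra of subsets of the common refinement `T`.) [cite: Krajicek1995, Lemma 12.4.4] -/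
theorem H_eq_S_of_isInferred (hΓ : SubClosed Γ) (hk : 18 * k ≤ E.R.card)
    {prev : List (PropForm ℕ)} {θ : PropForm ℕ} (hθ : θ ∈ Γ)
    (hprev : ∀ p ∈ prev, p ∈ Γ ∧ E.H p = E.S p) (hinf : textbookFrege.IsInferred prev θ) :
    E.H θ = E.S θ := by
  obtain ⟨r, hr, σ, hconc, hprem⟩ := hinf
  simp only [textbookFrege, List.mem_cons, List.not_mem_nil, or_false] at hr
  rcases hr with rfl | rfl | rfl | rfl | rfl | rfl | rfl | rfl | rfl <;>
    simp only [PropForm.subst, List.mem_cons, List.not_mem_nil, or_false, forall_eq_or_imp,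
      forall_eq] at hconc hprem
  · -- (1) `⊢ ¬A ∨ A`
    subst hconc
    set A := σ 0
    have hnA : PropForm.neg A ∈ Γ := hΓ.mem_of_disj_left hθ
    have hA : A ∈ Γ := hΓ.mem_of_neg hnA
    have hh : HomHyp E [A, .neg A, .disj (.neg A) A] :=
      ⟨by simp [hA, hnA, hθ], by simp, hk⟩
    rw [← hh.v_eq_T_iff (by simp), hh.v_disj (by simp) (by simp) (by simp), hh.v_neg (by simp) hnA]
    exact sdiff_union_of_subset (E.v_subset _)
  · -- (2) expansion `A ⊢ B ∨ A`
    subst hconc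
    set A := σ 0
    set B := σ 1
    have hA : A ∈ Γ := hΓ.mem_of_disj_right hθ
    have hB : B ∈ Γ := hΓ.mem_of_disj_left hθ
    have hh : HomHyp E [A, B, .disj B A] := ⟨by simp [hA, hB, hθ], by simp, hk⟩
    have hAt : E.v _ A = E.T [A, B, .disj B A] := (hh.v_eq_T_iff (by simp)).2 (hprev _ hprem).2
    rw [← hh.v_eq_T_iff (by simp), hh.v_disj (by simp) (by simp) (by simp), hAt]
    exact Finset.union_eq_right.2 (E.v_subset _)
  · -- (3) contraction `A ∨ A ⊢ A`
    subst hconc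
    set A := σ 0
    have hAA : PropForm.disj A A ∈ Γ := (hprev _ hprem).1
    have hh : HomHyp E [A, .disj A A] := ⟨by simp [hθ, hAA], by simp, hk⟩
    have hAt : E.v _ (.disj A A) = E.T [A, .disj A A] :=
      (hh.v_eq_T_iff (by simp)).2 (hprev _ hprem).2
    rw [← hh.v_eq_T_iff (by simp)]
    rwa [hh.v_disj (by simp) (by simp) (by simp), Finset.union_idempotent] at hAt
  · -- (4) associativity `A ∨ (B ∨ C) ⊢ (A ∨ B) ∨ C`
    subst hconc
    set A := σ 0
    set B := σ 1
    set C := σ 2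
    have hp : PropForm.disj A (.disj B C) ∈ Γ := (hprev _ hprem).1
    have hAB : PropForm.disj A B ∈ Γ := hΓ.mem_of_disj_left hθ
    have hA : A ∈ Γ := hΓ.mem_of_disj_left hAB
    have hB : B ∈ Γ := hΓ.mem_of_disj_right hAB
    have hC : C ∈ Γ := hΓ.mem_of_disj_right hθ
    have hBC : PropForm.disj B C ∈ Γ := hΓ.mem_of_disj_right hp
    have hh : HomHyp E [A, B, C, .disj B C, .disj A (.disj B C), .disj A B, .disj (.disj A B) C] :=
      ⟨by simp [hA, hB, hC, hBC, hp, hAB, hθ], by simp, hk⟩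
    have hAt := (hh.v_eq_T_iff (by simp)).2 (hprev _ hprem).2
    rw [hh.v_disj (by simp) (by simp) (by simp), hh.v_disj (by simp) (by simp) (by simp)] at hAt
    rw [← hh.v_eq_T_iff (by simp), hh.v_disj (by simp) (by simp) (by simp),
      hh.v_disj (by simp) (by simp) (by simp), Finset.union_assoc, hAt]
  · -- (5) cut `A ∨ B, ¬A ∨ C ⊢ B ∨ C`
    subst hconc
    set A := σ 0
    set B := σ 1
    set C := σ 2
    have hAB : PropForm.disj A B ∈ Γ := (hprev _ hprem.1).1
    have hnAC : PropForm.disj (.neg A) C ∈ Γ := (hprev _ hprem.2).1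
    have hA : A ∈ Γ := hΓ.mem_of_disj_left hAB
    have hB : B ∈ Γ := hΓ.mem_of_disj_right hAB
    have hC : C ∈ Γ := hΓ.mem_of_disj_right hθ
    have hnA : PropForm.neg A ∈ Γ := hΓ.mem_of_disj_left hnAC
    have hh : HomHyp E [A, B, C, .disj A B, .neg A, .disj (.neg A) C, .disj B C] :=
      ⟨by simp [hA, hB, hC, hAB, hnA, hnAC, hθ], by simp, hk⟩
    have h1 := (hh.v_eq_T_iff (by simp)).2 (hprev _ hprem.1).2
    have h2 := (hh.v_eq_T_iff (by simp)).2 (hprev _ hprem.2).2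
    rw [hh.v_disj (by simp) (by simp) (by simp)] at h1
    rw [hh.v_disj (by simp) (by simp) (by simp), hh.v_neg (by simp) hnA] at h2
    rw [← hh.v_eq_T_iff (by simp), hh.v_disj (by simp) (by simp) (by simp)]
    exact cut_algebra (E.v_subset _) (E.v_subset _) h1 h2
  · -- (6) `⊢ ¬(A ∧ B) ∨ ¬(¬A ∨ ¬B)`
    subst hconc
    set A := σ 0
    set B := σ 1
    have h1 : PropForm.neg (.conj A B) ∈ Γ := hΓ.mem_of_disj_left hθ
    have h2 : PropForm.conj A B ∈ Γ := hΓ.mem_of_neg h1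
    have hA : A ∈ Γ := hΓ.mem_of_conj_left h2
    have hB : B ∈ Γ := hΓ.mem_of_conj_right h2
    have h3 : PropForm.neg (.disj (.neg A) (.neg B)) ∈ Γ := hΓ.mem_of_disj_right hθ
    have h4 : PropForm.disj (.neg A) (.neg B) ∈ Γ := hΓ.mem_of_neg h3
    have hnA : PropForm.neg A ∈ Γ := hΓ.mem_of_disj_left h4
    have hnB : PropForm.neg B ∈ Γ := hΓ.mem_of_disj_right h4
    have hh : HomHyp E [A, B, .conj A B, .neg (.conj A B), .neg A, .neg B, .disj (.neg A) (.neg B),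
        .neg (.disj (.neg A) (.neg B)), .disj (.neg (.conj A B)) (.neg (.disj (.neg A) (.neg B)))] :=
      ⟨by simp [hA, hB, h2, h1, hnA, hnB, h4, h3, hθ], by simp, hk⟩
    rw [← hh.v_eq_T_iff (by simp), hh.v_disj (by simp) (by simp) (by simp), hh.v_neg (by simp) h1,
      hh.v_conj (by simp) (by simp) (by simp), hh.v_neg (by simp) h3,
      hh.v_disj (by simp) (by simp) (by simp), hh.v_neg (by simp) hnA, hh.v_neg (by simp) hnB]
    exact conjAx₁_algebra _ _ _
  · -- (7) `⊢ ¬¬(¬A ∨ ¬B) ∨ (A ∧ B)`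
    subst hconc
    set A := σ 0
    set B := σ 1
    have h1 : PropForm.neg (.neg (.disj (.neg A) (.neg B))) ∈ Γ := hΓ.mem_of_disj_left hθ
    have h2 : PropForm.neg (.disj (.neg A) (.neg B)) ∈ Γ := hΓ.mem_of_neg h1
    have h3 : PropForm.disj (.neg A) (.neg B) ∈ Γ := hΓ.mem_of_neg h2
    have hnA : PropForm.neg A ∈ Γ := hΓ.mem_of_disj_left h3
    have hnB : PropForm.neg B ∈ Γ := hΓ.mem_of_disj_right h3
    have h4 : PropForm.conj A B ∈ Γ := hΓ.mem_of_disj_right hθ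
    have hA : A ∈ Γ := hΓ.mem_of_conj_left h4
    have hB : B ∈ Γ := hΓ.mem_of_conj_right h4
    have hh : HomHyp E [A, B, .neg A, .neg B, .disj (.neg A) (.neg B), .neg (.disj (.neg A) (.neg B)),
        .neg (.neg (.disj (.neg A) (.neg B))), .conj A B,
        .disj (.neg (.neg (.disj (.neg A) (.neg B)))) (.conj A B)] :=
      ⟨by simp [hA, hB, hnA, hnB, h3, h2, h1, h4, hθ], by simp, hk⟩
    rw [← hh.v_eq_T_iff (by simp), hh.v_disj (by simp) (by simp) (by simp), hh.v_neg (by simp) h1,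
      hh.v_neg (by simp) h2, hh.v_disj (by simp) (by simp) (by simp), hh.v_neg (by simp) hnA,
      hh.v_neg (by simp) hnB, hh.v_conj (by simp) (by simp) (by simp)]
    exact conjAx₂_algebra (E.v_subset _) (E.v_subset _)
  · -- (8) `⊢ ⊤`
    subst hconc
    exact E.H_true hθ
  · -- (9) `⊢ ¬⊥`
    subst hconc
    have hbot : PropForm.const false ∈ Γ := hΓ.mem_of_neg hθ
    rw [E.neg_H _ hθ, E.neg_S _ hθ, E.H_false hbot, Finset.sdiff_empty]

/-- **All lines of a proof are true.** For a `k`-evaluation of a subformula-closed `Γ` with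
`18 k ≤ |R^ρ|`, every line of a `textbookFrege`-derivation from no hypotheses all of whose lines
lie in `Γ` satisfies `H = S`. [cite: Krajicek1995, Thm. 12.5.3 (proof: H_{θ_i} = S_{θ_i} for all steps)] -/
theorem H_eq_S_of_isDerivation (hΓ : SubClosed Γ) (hk : 18 * k ≤ E.R.card)
    {π : List (PropForm ℕ)} (hπ : textbookFrege.IsDerivation ∅ π) (hπΓ : ∀ θ ∈ π, θ ∈ Γ) :
    ∀ θ ∈ π, E.H θ = E.S θ := by
  suffices h : ∀ (i : ℕ) (hi : i < π.length), E.H π[i] = E.S π[i] by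
    intro θ hθ
    obtain ⟨i, hi, rfl⟩ := List.getElem_of_mem hθ
    exact h i hi
  intro i
  induction i using Nat.strong_induction_on with
  | _ i ih =>
    intro hi
    rcases hπ i hi with hm | hinf
    · exact absurd hm (Set.notMem_empty _)
    · refine E.H_eq_S_of_isInferred hΓ hk (hπΓ _ (List.getElem_mem hi)) (fun p hp => ?_) hinf
      obtain ⟨j, hj, rfl⟩ := List.getElem_of_mem hp
      rw [List.length_take] at hj
      rw [List.getElem_take]
      exact ⟨hπΓ _ (List.getElem_mem (by omega)), ih j (by omega) (by omega)⟩

end Rules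

/-! ### Lemma 12.5.2 (for the injective `PHP^{n+1}_n`): the pigeonhole axioms are forced -/

section PHP

/-- The formula of a literal, as rendered by `PropForm.ofCNF`. [cite: Krajicek1995, Def. 12.5.1] -/
def litForm (l : Literal ℕ) : PropForm ℕ :=
  if l.2 then .var l.1 else .neg (.var l.1)

/-- The formula of a clause, as rendered by `PropForm.ofCNF`: `l₁ ∨ (l₂ ∨ (⋯ ∨ ⊥))`. [cite: Krajicek1995, Def. 12.5.1] -/
def clauseForm (c : Clause ℕ) : PropForm ℕ :=
  c.foldr (fun l d => .disj (litForm l) d) (.const false)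

/-- Unfolding the clause formula. [folklore] -/
theorem clauseForm_cons (l : Literal ℕ) (c : Clause ℕ) :
    clauseForm (l :: c) = .disj (litForm l) (clauseForm c) := rfl

/-- Unfolding `ofCNF` one clause at a time. [folklore] -/
theorem ofCNF_cons (c : Clause ℕ) (φ : CNF ℕ) :
    PropForm.ofCNF (c :: φ) = .conj (clauseForm c) (PropForm.ofCNF φ) := rfl

/-- A literal formula is its own disjunctive block. [folklore] -/
theorem dkids_litForm (l : Literal ℕ) : dkids (litForm l) = {litForm l} := by
  unfold litForm; split <;> rfl

/-- The literals of a clause are disjunctive block children of its formula. [folklore] -/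
theorem litForm_mem_dkids_clauseForm {c : Clause ℕ} {l : Literal ℕ} (hl : l ∈ c) :
    litForm l ∈ dkids (clauseForm c) := by
  induction c with
  | nil => exact absurd hl List.not_mem_nil
  | cons l' c ih =>
    rw [clauseForm_cons, dkids_disj, Finset.mem_union, dkids_litForm, Finset.mem_singleton]
    rcases List.mem_cons.1 hl with rfl | hl
    · exact Or.inl rfl
    · exact Or.inr (ih hl)

/-- The conjunctive block children of `ofCNF φ` (all clauses nonempty) are the clause formulas
and the final constant `⊤`. [folklore] -/
theorem mem_ckids_ofCNF {φ : CNF ℕ} (hφ : ∀ c ∈ φ, c ≠ []) {ξ : PropForm ℕ}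
    (hξ : ξ ∈ ckids (PropForm.ofCNF φ)) : ξ = .const true ∨ ∃ c ∈ φ, ξ = clauseForm c := by
  induction φ with
  | nil => left; simpa [PropForm.ofCNF] using hξ
  | cons c φ ih =>
    rw [ofCNF_cons, ckids_conj, Finset.mem_union] at hξ
    rcases hξ with hξ | hξ
    · obtain ⟨l, c', rfl⟩ := List.exists_cons_of_ne_nil (hφ c List.mem_cons_self)
      rw [clauseForm_cons, ckids_disj, Finset.mem_singleton] at hξ
      exact Or.inr ⟨_, List.mem_cons_self, hξ⟩
    · rcases ih (fun c' hc' => hφ c' (List.mem_cons_of_mem _ hc')) hξ with h | ⟨c', hc', h⟩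
      · exact Or.inl h
      · exact Or.inr ⟨c', List.mem_cons_of_mem _ hc', h⟩

/-- Clause formulas are conjunctive block children of `ofCNF φ`. [folklore] -/
theorem clauseForm_mem_ckids_ofCNF {φ : CNF ℕ} {c : Clause ℕ} (hc : c ∈ φ) (hne : c ≠ []) :
    clauseForm c ∈ ckids (PropForm.ofCNF φ) := by
  induction φ with
  | nil => exact absurd hc List.not_mem_nil
  | cons c' φ ih =>
    rw [ofCNF_cons, ckids_conj, Finset.mem_union]
    rcases List.mem_cons.1 hc with rfl | hc
    · obtain ⟨l, c'', rfl⟩ := List.exists_cons_of_ne_nil hne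
      left; rw [clauseForm_cons, ckids_disj, Finset.mem_singleton]
    · exact Or.inr (ih hc)

variable (E : KEval n ρ k Γ)

/-- A block all of whose conjunctive children are true is true. [cite: Krajicek1995, Lemma 12.5.2 (proof, dual reading)] -/
theorem H_eq_S_of_ckids {φ : PropForm ℕ} (hφ : φ ∈ Γ) (h : ∀ ξ ∈ ckids φ, E.H ξ = E.S ξ) :
    E.H φ = E.S φ := by
  obtain ⟨-, hH⟩ := E.cU_spec hφ
  have hcU : E.cU φ = ∅ := by
    rw [cU, ← Finset.not_nonempty_iff_eq_empty, Finset.biUnion_nonempty]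
    rintro ⟨ξ, hξ, hne⟩
    rw [h ξ hξ, Finset.sdiff_self] at hne
    exact Finset.not_nonempty_empty hne
  rw [hH, hcU, proj_empty, Finset.sdiff_empty]

/-- A clause one of whose literals has a true-part element compatible with every `α ∈ S` is
forced true: `H = S`. [cite: Krajicek1995, Lemma 12.5.2 (proof: S_η(T) = S_η)] -/
theorem H_clauseForm_eq_S {c : Clause ℕ} (hc : clauseForm c ∈ Γ)
    (hforce : ∀ α ∈ E.S (clauseForm c), ∃ l ∈ c, ∃ γ ∈ E.H (litForm l), Compat γ α) :
    E.H (clauseForm c) = E.S (clauseForm c) := by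
  obtain ⟨hr, hH⟩ := E.dU_spec hc
  rw [hH]
  refine proj_eq_self_of_forall_exists_compat hr fun α hα => ?_
  obtain ⟨l, hl, γ, hγ, hcomp⟩ := hforce α hα
  exact ⟨γ, Finset.mem_biUnion.2 ⟨litForm l, litForm_mem_dkids_clauseForm hl, hγ⟩, hcomp⟩

/-- For a killed-or-true atom of a hole clause: if `H(¬p) = S(p)` is a complete system, it has
an element compatible with any small `α`. [folklore] -/
theorem exists_compat_of_complete {x : ℕ} (hx : PropForm.var x ∈ Γ) {α : Finset (ℕ × ℕ)}
    (hα : IsPMatching α) (hαs : α ⊆ E.D ×ˢ E.R) (hcard : α.card + k ≤ E.R.card) :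
    ∃ γ ∈ E.S (.var x), Compat γ α :=
  (E.complete _ hx).exists_compat α hα hαs hcard

/-- **Pigeon clauses are forced.** For pigeon `i ≤ n`, the clause `⋁_{j<n} p_{ij}` of
`PHP^{n+1}_n` is true in every `k`-evaluation with `2k + 1 ≤ |R^ρ|`… precisely `k + 1 ≤ |R|` for
the fresh hole and `2k ≤ |R|` for completeness. [cite: Krajicek1995, Lemma 12.5.2 (proof, η := ⋁_{i∈X} p_X)] -/
theorem pigeonClause_forced (hΓ : SubClosed Γ) (hk : 2 * k + 1 ≤ E.R.card) {i : ℕ} (hi : i < n + 1)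
    (hc : clauseForm ((List.range n).map fun j => (i * n + j, true)) ∈ Γ) :
    E.H (clauseForm ((List.range n).map fun j => (i * n + j, true))) =
      E.S (clauseForm ((List.range n).map fun j => (i * n + j, true))) := by
  refine E.H_clauseForm_eq_S hc fun α hα => ?_
  have hS := E.complete _ hc
  have hαm : IsPMatching α := hS.isPMatching α hα
  have hαs : α ⊆ E.D ×ˢ E.R := hS.subset α hα
  have hαk : α.card ≤ k := hS.card_le α hα
  -- membership of the literal formulas in `Γ`
  have hlit : ∀ j < n, PropForm.var (i * n + j) ∈ Γ := by
    intro j hj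
    have := hΓ.dkids_subset hc (litForm_mem_dkids_clauseForm (l := (i * n + j, true))
      (List.mem_map.2 ⟨j, List.mem_range.2 hj, rfl⟩))
    simpa [litForm] using this
  by_cases hid : i ∈ dom ρ
  · -- `ρ(i) = j₀`: the atom `p_{i j₀}` is set true, `H = S` is complete
    obtain ⟨j₀, hj₀⟩ := mem_dom.1 hid
    have hj₀n : j₀ < n := by
      have := E.ρ_subset hj₀
      simp only [Finset.mem_product, Finset.mem_range] at this
      exact this.2
    have hx := hlit j₀ hj₀n
    obtain ⟨γ, hγ, hcomp⟩ := E.exists_compat_of_complete hx hαm hαs (by omega)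
    refine ⟨(i * n + j₀, true), List.mem_map.2 ⟨j₀, List.mem_range.2 hj₀n, rfl⟩, γ, ?_, hcomp⟩
    simp only [litForm, if_true]
    rwa [E.setTrue _ hx (by rw [atomOf_mul_add hj₀n]; exact hj₀)]
  · -- pigeon `i` is free: find a hole `j₁` with `{(i, j₁)}` compatible with `α`, a live atom
    have hiD : i ∈ E.D := Finset.mem_sdiff.2 ⟨Finset.mem_range.2 hi, hid⟩
    obtain ⟨j₁, hj₁R, hcomp⟩ : ∃ j₁ ∈ E.R, Compat {(i, j₁)} α := by
      by_cases hia : i ∈ dom α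
      · obtain ⟨j₁, hj₁⟩ := mem_dom.1 hia
        exact ⟨j₁, (Finset.mem_product.1 (hαs hj₁)).2, hαm.compat_singleton_of_mem hj₁⟩
      · have h : (E.R \ rng α).Nonempty := by
          rw [← Finset.card_pos]
          have h1 := card_le_card_sdiff_add E.R (rng α)
          rw [hαm.card_rng] at h1
          omega
        obtain ⟨j₁, hj₁⟩ := h
        rw [Finset.mem_sdiff] at hj₁
        exact ⟨j₁, hj₁.1, hαm.compat_singleton_of_fresh hia hj₁.2⟩
    have hj₁ := Finset.mem_sdiff.1 hj₁R
    have hj₁n : j₁ < n := Finset.mem_range.1 hj₁.1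
    have hx := hlit j₁ hj₁n
    have hlive : IsLiveAtom n ρ (i * n + j₁) := by
      refine ⟨by nlinarith, ?_, ?_⟩ <;> rw [atomOf_mul_add hj₁n]
      · exact hid
      · exact hj₁.2
    refine ⟨(i * n + j₁, true), List.mem_map.2 ⟨j₁, List.mem_range.2 hj₁n, rfl⟩, {(i, j₁)}, ?_, hcomp⟩
    simp only [litForm, if_true]
    rw [(E.live _ hx hlive).2, atomOf_mul_add hj₁n]
    exact Finset.mem_singleton_self _

/-- For a live atom `p_{ij}` and a small matching `α` not containing `(i, j)`, the false part
`H(¬p_{ij}) = S(p_{ij}) ∖ {{(i,j)}}` has an element compatible with `α`.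
[cite: Krajicek1995, Lemma 12.5.2 (proof, via Lemma 12.3.2(2))] -/
theorem exists_compat_negLive {x : ℕ} (hx : PropForm.var x ∈ Γ) (hnx : PropForm.neg (.var x) ∈ Γ)
    (hlive : IsLiveAtom n ρ x) {α : Finset (ℕ × ℕ)} (hα : IsPMatching α) (hαs : α ⊆ E.D ×ˢ E.R)
    (hcard : α.card + 2 ≤ E.R.card) (hmem : atomOf n x ∉ α) :
    ∃ γ ∈ E.H (.neg (.var x)), Compat γ α := by
  obtain ⟨hS, hH⟩ := E.live x hx hlive
  have hiD : (atomOf n x).1 ∈ E.D := by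
    have := atomOf_mem_product hlive.1
    rw [Finset.mem_product] at this
    exact Finset.mem_sdiff.2 ⟨this.1, hlive.2.1⟩
  have hmem' : ((atomOf n x).1, (atomOf n x).2) ∉ α := by simpa using hmem
  obtain ⟨i', hi'D, j', hj'R, hi', hj', hc⟩ :=
    exists_pair_compat_of_not_mem hiD (by rw [E.card_D]; omega) hα hαs hcard hmem'
  refine ⟨{((atomOf n x).1, j'), (i', (atomOf n x).2)}, ?_, hc⟩
  rw [E.neg_H _ hnx, hS, hH, Finset.mem_sdiff, mem_atomSystem, Finset.mem_singleton]
  refine ⟨Or.inr ⟨i', hi'D, j', hj'R, hi', hj', rfl⟩, fun h => ?_⟩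
  have : ((atomOf n x).1, j') ∈ ({atomOf n x} : Finset (ℕ × ℕ)) := by
    rw [← h]; exact Finset.mem_insert_self _ _
  rw [Finset.mem_singleton, Prod.ext_iff] at this
  exact hj' this.2

/-- For an atom that is not live, `H(¬p) ⊇`… precisely: `H(¬p)` contains a member compatible with
any small `α` (if `p` is set true or killed, `H(¬p) = S(p) ∖ H(p)` with `H(p) = S(p)` impossible
for the partner of a hole clause — handled by the caller — or `H(p) = ∅`). Killed case.
[cite: Krajicek1995, Lemma 12.5.2 (proof, restricted formula)] -/
theorem exists_compat_negDead {x : ℕ} (hx : PropForm.var x ∈ Γ) (hnx : PropForm.neg (.var x) ∈ Γ)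
    (hnot : atomOf n x ∉ ρ) (hnl : ¬ IsLiveAtom n ρ x) {α : Finset (ℕ × ℕ)} (hα : IsPMatching α)
    (hαs : α ⊆ E.D ×ˢ E.R) (hcard : α.card + k ≤ E.R.card) :
    ∃ γ ∈ E.H (.neg (.var x)), Compat γ α := by
  rw [E.neg_H _ hnx, E.dead x hx hnot hnl, Finset.sdiff_empty]
  exact E.exists_compat_of_complete hx hα hαs hcard

/-- **Hole clauses are forced.** For pigeons `i < i' ≤ n` and hole `j < n`, the clause
`¬p_{ij} ∨ ¬p_{i'j}` of `PHP^{n+1}_n` is true in every `k`-evaluation with `k + 2 ≤ |R^ρ|`.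
[cite: Krajicek1995, Lemma 12.5.2 (proof, η := p_X ∧ p_Y)] -/
theorem holeClause_forced (hΓ : SubClosed Γ) (hk : 2 * k + 2 ≤ E.R.card) {i i' j : ℕ}
    (hii' : i < i') (hj : j < n)
    (hc : clauseForm [(i * n + j, false), (i' * n + j, false)] ∈ Γ) :
    E.H (clauseForm [(i * n + j, false), (i' * n + j, false)]) =
      E.S (clauseForm [(i * n + j, false), (i' * n + j, false)]) := by
  refine E.H_clauseForm_eq_S hc fun α hα => ?_
  have hS := E.complete _ hc
  have hαm : IsPMatching α := hS.isPMatching α hα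
  have hαs : α ⊆ E.D ×ˢ E.R := hS.subset α hα
  have hαk : α.card ≤ k := hS.card_le α hα
  -- the two negated atoms are in `Γ`
  have hn1 : PropForm.neg (.var (i * n + j)) ∈ Γ := by
    have := hΓ.dkids_subset hc (litForm_mem_dkids_clauseForm (l := (i * n + j, false))
      (by simp))
    simpa [litForm] using this
  have hn2 : PropForm.neg (.var (i' * n + j)) ∈ Γ := by
    have := hΓ.dkids_subset hc (litForm_mem_dkids_clauseForm (l := (i' * n + j, false))
      (by simp))
    simpa [litForm] using this
  have hv1 : PropForm.var (i * n + j) ∈ Γ := hΓ.mem_of_neg hn1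
  have hv2 : PropForm.var (i' * n + j) ∈ Γ := hΓ.mem_of_neg hn2
  have ha1 : atomOf n (i * n + j) = (i, j) := atomOf_mul_add hj
  have ha2 : atomOf n (i' * n + j) = (i', j) := atomOf_mul_add hj
  -- generic dispatch on the status of an atom `x` with partner `x'` sharing the hole `j`
  have key : ∀ {x x' p p' : ℕ}, PropForm.var x ∈ Γ → PropForm.neg (.var x) ∈ Γ →
      PropForm.var x' ∈ Γ → PropForm.neg (.var x') ∈ Γ →
      atomOf n x = (p, j) → atomOf n x' = (p', j) → p ≠ p' → ¬ IsLiveAtom n ρ x →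
      (∃ γ ∈ E.H (.neg (.var x)), Compat γ α) ∨ (∃ γ ∈ E.H (.neg (.var x')), Compat γ α) := by
    intro x x' p p' hx hnx hx' hnx' hax hax' hpp' hnl
    by_cases hmem : atomOf n x ∈ ρ
    · -- `x` set true: then the partner `x'` is killed (`j ∈ rng ρ`, `(p', j) ∉ ρ`)
      right
      rw [hax] at hmem
      have hnot' : atomOf n x' ∉ ρ := by
        rw [hax']; intro h'
        exact hpp' (E.isPMatching.eq_of_snd_eq hmem h')
      have hnl' : ¬ IsLiveAtom n ρ x' := by
        rintro ⟨-, -, hr⟩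
        rw [hax'] at hr
        exact hr (mem_rng.2 ⟨p, hmem⟩)
      exact E.exists_compat_negDead hx' hnx' hnot' hnl' hαm hαs (by omega)
    · left
      exact E.exists_compat_negDead hx hnx hmem hnl hαm hαs (by omega)
  by_cases hl1 : IsLiveAtom n ρ (i * n + j)
  · by_cases hl2 : IsLiveAtom n ρ (i' * n + j)
    · -- both live
      by_cases hmem : (i, j) ∈ α
      · have hmem' : (i', j) ∉ α := fun h => (Nat.ne_of_lt hii') (hαm.eq_of_snd_eq hmem h)
        obtain ⟨γ, hγ, hcomp⟩ := E.exists_compat_negLive hv2 hn2 hl2 hαm hαs (by omega)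
          (by rwa [ha2])
        exact ⟨(i' * n + j, false), by simp, γ, by simpa [litForm] using hγ, hcomp⟩
      · obtain ⟨γ, hγ, hcomp⟩ := E.exists_compat_negLive hv1 hn1 hl1 hαm hαs (by omega)
          (by rwa [ha1])
        exact ⟨(i * n + j, false), by simp, γ, by simpa [litForm] using hγ, hcomp⟩
    · rcases key hv2 hn2 hv1 hn1 ha2 ha1 (Nat.ne_of_lt hii').symm hl2 with ⟨γ, hγ, hcomp⟩ | ⟨γ, hγ, hcomp⟩
      · exact ⟨(i' * n + j, false), by simp, γ, by simpa [litForm] using hγ, hcomp⟩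
      · exact ⟨(i * n + j, false), by simp, γ, by simpa [litForm] using hγ, hcomp⟩
  · rcases key hv1 hn1 hv2 hn2 ha1 ha2 (Nat.ne_of_lt hii') hl1 with ⟨γ, hγ, hcomp⟩ | ⟨γ, hγ, hcomp⟩
    · exact ⟨(i * n + j, false), by simp, γ, by simpa [litForm] using hγ, hcomp⟩
    · exact ⟨(i' * n + j, false), by simp, γ, by simpa [litForm] using hγ, hcomp⟩

/-- The clauses of `PHP^{n+1}_n`, unfolded. [cite: Haken1985, §1] -/
theorem mem_pigeonholeCNF_iff {n : ℕ} {c : Clause ℕ} :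
    c ∈ pigeonholeCNF (n + 1) n ↔
      (∃ i < n + 1, c = (List.range n).map fun j => (i * n + j, true)) ∨
      ∃ j < n, ∃ i' < n + 1, ∃ i < i', c = [(i * n + j, false), (i' * n + j, false)] := by
  simp only [pigeonholeCNF, List.mem_append, List.mem_map, List.mem_range, List.mem_flatMap]
  constructor
  · rintro (⟨i, hi, rfl⟩ | ⟨j, hj, i', hi', i, hi, rfl⟩)
    · exact Or.inl ⟨i, hi, rfl⟩
    · exact Or.inr ⟨j, hj, i', hi', i, hi, rfl⟩
  · rintro (⟨i, hi, rfl⟩ | ⟨j, hj, i', hi', i, hi, rfl⟩)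
    · exact Or.inl ⟨i, hi, rfl⟩
    · exact Or.inr ⟨j, hj, i', hi', i, hi, rfl⟩

/-- For `0 < n` every clause of `PHP^{n+1}_n` is nonempty. [cite: Haken1985, §1] -/
theorem ne_nil_of_mem_pigeonholeCNF {n : ℕ} (hn : 0 < n) {c : Clause ℕ}
    (hc : c ∈ pigeonholeCNF (n + 1) n) : c ≠ [] := by
  rcases mem_pigeonholeCNF_iff.1 hc with ⟨i, -, rfl⟩ | ⟨j, -, i', -, i, -, rfl⟩
  · intro h
    rw [List.map_eq_nil_iff, List.range_eq_nil] at h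
    omega
  · exact List.cons_ne_nil _ _

/-- **Lemma 12.5.2 (for `PHP^{n+1}_n`)**: in a `k`-evaluation of a subformula-closed `Γ`
containing `⋀ PHP^{n+1}_n = ofCNF (pigeonholeCNF (n+1) n)` with `2k + 2 ≤ |R^ρ|`, the conjunction
of the pigeonhole clauses is TRUE (`H = S`), hence the pigeonhole tautology `¬ ⋀ PHP^{n+1}_n` is
false, `H = ∅`. (Krajíček's `PHP_n` is the bijective version written as a disjunction; the clauses
of the injective version are forced true in exactly the same way.) [cite: Krajicek1995, Lemma 12.5.2] -/
theorem H_ofCNF_pigeonholeCNF_eq_S (hΓ : SubClosed Γ) (hk : 2 * k + 2 ≤ E.R.card)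
    (hX : PropForm.ofCNF (pigeonholeCNF (n + 1) n) ∈ Γ) :
    E.H (PropForm.ofCNF (pigeonholeCNF (n + 1) n)) = E.S (PropForm.ofCNF (pigeonholeCNF (n + 1) n)) := by
  have hn : 0 < n := by
    have := E.card_R_add; have := Finset.card_le_card (Finset.sdiff_subset (s := range n) (t := rng ρ))
    simp only [Finset.card_range] at this
    change (range n \ rng ρ).card ≤ n at this
    have hR : 2 ≤ E.R.card := by omega
    change 2 ≤ (range n \ rng ρ).card at hR
    omega
  refine E.H_eq_S_of_ckids hX fun ξ hξ => ?_
  have hξΓ : ξ ∈ Γ := hΓ.ckids_subset hX hξ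
  rcases mem_ckids_ofCNF (fun c hc => ne_nil_of_mem_pigeonholeCNF hn hc) hξ with rfl | ⟨c, hc, rfl⟩
  · exact E.H_true hξΓ
  · rcases mem_pigeonholeCNF_iff.1 hc with ⟨i, hi, rfl⟩ | ⟨j, hj, i', -, i, hi, rfl⟩
    · exact E.pigeonClause_forced hΓ (by omega) hi hξΓ
    · exact E.holeClause_forced hΓ hk hi hj hξΓ

/-- **The pigeonhole tautology is false in every `k`-evaluation**: `H(¬ ⋀ PHP^{n+1}_n) = ∅`.
[cite: Krajicek1995, Lemma 12.5.2] -/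
theorem H_pigeonholeForm_eq_empty (hΓ : SubClosed Γ) (hk : 2 * k + 2 ≤ E.R.card)
    (hθ : PropForm.neg (PropForm.ofCNF (pigeonholeCNF (n + 1) n)) ∈ Γ) :
    E.H (.neg (PropForm.ofCNF (pigeonholeCNF (n + 1) n))) = ∅ := by
  rw [E.neg_H _ hθ, E.H_ofCNF_pigeonholeCNF_eq_S hΓ hk (hΓ.mem_of_neg hθ), Finset.sdiff_self]

/-- **No `k`-evaluation of a proof of the pigeonhole principle** (the combinatorial core of
Krajíček 1995, Thm. 12.5.3 = Ajtai 1988 / Beame et al. 1992, for the Frege system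
`textbookFrege` and `PHP^{n+1}_n`): if `(H, S)` is a `k`-evaluation, relative to some restriction
`ρ`, of a subformula-closed set `Γ` containing every line of a `textbookFrege`-proof `π` of
`¬ ⋀ PHP^{n+1}_n` (`= pigeonholeForm (n+1) n`), then `18 k + 3 ≤ |R^ρ|` is impossible: by
Lemma 12.4.4 the last line would be true (`H = S ≠ ∅`), by Lemma 12.5.2 it is false (`H = ∅`).
[cite: Krajicek1995, Thm. 12.5.3 (proof)] -/
theorem not_isProofOf_pigeonhole (hΓ : SubClosed Γ) (hk : 18 * k + 3 ≤ E.R.card)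
    {π : List (PropForm ℕ)} (hπΓ : ∀ θ ∈ π, θ ∈ Γ)
    (hπ : textbookFrege.IsProofOf π (.neg (PropForm.ofCNF (pigeonholeCNF (n + 1) n)))) : False := by
  set θ := PropForm.neg (PropForm.ofCNF (pigeonholeCNF (n + 1) n))
  have hθπ : θ ∈ π := List.mem_of_getLast? hπ.2
  have hθΓ : θ ∈ Γ := hπΓ θ hθπ
  have h1 : E.H θ = E.S θ := E.H_eq_S_of_isDerivation hΓ (by omega) hπ.1 hπΓ θ hθπ
  have h2 : E.H θ = ∅ := E.H_pigeonholeForm_eq_empty hΓ (by omega) hθΓ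
  have hkR : k ≤ E.R.card := by omega
  have h3 : (E.S θ).Nonempty := (E.complete θ hθΓ).nonempty hkR
  rw [← h1, h2] at h3
  exact Finset.not_nonempty_empty h3

end PHP

end KEval

end Literature.Computability.MetaComplexity
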